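import Summits.ValiantsHypothesis.ValiantsHypothesis.Theses.RefutationDegree
import Literature.Computability.Complexity.HermitianSosRefutation

/-!
# ValiantsHypothesis / RefutationDegree — `NsToSos`

Route `RefutationDegree`, item `stmt-ValiantsHypothesis-5646` (support, rank 9): a
Nullstellensatz refutation of degree `d` of the coefficient system `Rep(n,m)`
("`per_n = det (A₀ + Σ_e x_e A_e)`", one equation per `x`-monomial `μ`) is a Hermitian
sums-of-squares refutation of degree `d`.

The mathematics is the Literature lemma
`Literature.Computability.Complexity.HasNSRefutationOfDegree.hasHermitianSosRefutationOfDegree`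
(`k = 0` squares, `h' = -½ ·` the holomorphic lift of `h`; the conjugation
`cj = rename Sum.swap ∘ map conj = hermConj` is a ring map fixing `-½`).  What this file adds is
the dictionary between the route's INLINE certificate shapes (equations indexed by all
`μ : σ →₀ ℕ`, sums over `P.support`, degree bound for every `μ`) and the Literature vocabulary
`HasNSRefutationOfDegree` / `HasHermitianSosRefutationOfDegree` for the coefficient system
`μ ↦ P.coeff μ` of an arbitrary `P : MvPolynomial σ (MvPolynomial V ℂ)`:

* `hasNSRefutationOfDegree_coeff` — inline NS certificate ⇒ `HasNSRefutationOfDegree`;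
* `exists_sos_certificate_support_of_hasHermitianSosRefutationOfDegree_coeff` — a Hermitian SOS
  refutation (on any finite set of equations) ⇒ the inline SOS certificate over `P.support`
  (multipliers extended by `0`; equations off the support are `0`);
* `nsToSos_proof` — the item, for `P = det A(x) - per_n`.

The two bridges are stated for general `P` so that the other items of the route (`SosSound`,
`CertWindowQP`, `BeyondHessianSos`, `RefutationBarrier`), which inline the same shapes, can reuse
them.
-/

namespace Summit.ValiantsHypothesis.ValiantsHypothesis.Theorems

-- single-conjunct summit: `Summit.<Summit>.<Problem>` repeats the name by convention (D-0017)
set_option linter.dupNamespace false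

open MvPolynomial Literature.Computability.Complexity

variable {σ V : Type*}

/-- Inline NS certificate ⇒ Literature vocabulary: multipliers `h μ` with
`Σ_{μ ∈ supp P} h μ · coeff μ P = 1` and every product of total degree `≤ d` form a
Nullstellensatz refutation of degree `≤ d` of the coefficient system `μ ↦ coeff μ P` (axiom set
`s = P.support`). [folklore] -/
theorem hasNSRefutationOfDegree_coeff {K : Type*} [CommRing K]
    (P : MvPolynomial σ (MvPolynomial V K)) (d : ℕ) (h : (σ →₀ ℕ) → MvPolynomial V K)
    (hdeg : ∀ μ, (h μ * P.coeff μ).totalDegree ≤ d)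
    (hsum : ∑ μ ∈ P.support, h μ * P.coeff μ = 1) :
    HasNSRefutationOfDegree (fun μ : σ →₀ ℕ => P.coeff μ) d :=
  ⟨P.support, h, hsum, fun μ _ => hdeg μ⟩

/-- Literature vocabulary ⇒ inline SOS certificate: a Hermitian SOS refutation of degree `≤ d`
of the coefficient system `μ ↦ coeff μ P` (using any finite set `s` of equations) yields one in
the route's inline shape — the same squares, multipliers extended by `0` off `s`, the equation
sum taken over `P.support` (equations `μ ∉ P.support` are `0`, so the terms `μ ∈ s \ supp P`
vanish), the degree bound holding for every `μ`, and `cj` spelled out as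
`rename Sum.swap ∘ map conj`. [folklore] -/
theorem exists_sos_certificate_support_of_hasHermitianSosRefutationOfDegree_coeff
    (P : MvPolynomial σ (MvPolynomial V ℂ)) (d : ℕ)
    (H : HasHermitianSosRefutationOfDegree (fun μ : σ →₀ ℕ => P.coeff μ) d) :
    ∃ (k : ℕ) (q : Fin k → MvPolynomial (V ⊕ V) ℂ) (h : (σ →₀ ℕ) → MvPolynomial (V ⊕ V) ℂ),
      (∀ i, (q i * rename Sum.swap (map (starRingEnd ℂ) (q i))).totalDegree ≤ d) ∧
      (∀ μ, (h μ * rename Sum.inl (P.coeff μ)).totalDegree ≤ d) ∧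
      ∑ i, q i * rename Sum.swap (map (starRingEnd ℂ) (q i)) +
        ∑ μ ∈ P.support, (h μ * rename Sum.inl (P.coeff μ) +
          rename Sum.swap (map (starRingEnd ℂ) (h μ * rename Sum.inl (P.coeff μ)))) + 1 = 0 := by
  classical
  obtain ⟨s, k, q, h, hq, hh, hsum⟩ := H
  simp only [hermConj_apply] at hq hsum
  refine ⟨k, q, fun μ => if μ ∈ s then h μ else 0, hq, fun μ => ?_, ?_⟩
  · beta_reduce
    by_cases hμ : μ ∈ s
    · rw [if_pos hμ]; exact hh μ hμ
    · rw [if_neg hμ, zero_mul, totalDegree_zero]; exact Nat.zero_le _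
  · beta_reduce
    -- `Σ_{supp P} (extended terms) = Σ_{supp P ∩ s} (terms) = Σ_{s} (terms)`
    have hmid : ∑ μ ∈ P.support, ((if μ ∈ s then h μ else 0) * rename Sum.inl (P.coeff μ) +
          rename Sum.swap (map (starRingEnd ℂ)
            ((if μ ∈ s then h μ else 0) * rename Sum.inl (P.coeff μ)))) =
        ∑ μ ∈ s, (h μ * rename Sum.inl (P.coeff μ) +
          rename Sum.swap (map (starRingEnd ℂ) (h μ * rename Sum.inl (P.coeff μ)))) := by
      have h1 : ∑ μ ∈ P.support, ((if μ ∈ s then h μ else 0) * rename Sum.inl (P.coeff μ) +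
            rename Sum.swap (map (starRingEnd ℂ)
              ((if μ ∈ s then h μ else 0) * rename Sum.inl (P.coeff μ)))) =
          ∑ μ ∈ P.support ∩ s, ((if μ ∈ s then h μ else 0) * rename Sum.inl (P.coeff μ) +
            rename Sum.swap (map (starRingEnd ℂ)
              ((if μ ∈ s then h μ else 0) * rename Sum.inl (P.coeff μ)))) := by
        refine (Finset.sum_subset Finset.inter_subset_left fun μ hμP hμ => ?_).symm
        have hμs : μ ∉ s := fun hμs => hμ (Finset.mem_inter.mpr ⟨hμP, hμs⟩)
        rw [if_neg hμs, zero_mul, map_zero, map_zero, add_zero]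
      have h2 : ∑ μ ∈ P.support ∩ s, ((if μ ∈ s then h μ else 0) * rename Sum.inl (P.coeff μ) +
            rename Sum.swap (map (starRingEnd ℂ)
              ((if μ ∈ s then h μ else 0) * rename Sum.inl (P.coeff μ)))) =
          ∑ μ ∈ P.support ∩ s, (h μ * rename Sum.inl (P.coeff μ) +
            rename Sum.swap (map (starRingEnd ℂ) (h μ * rename Sum.inl (P.coeff μ)))) :=
        Finset.sum_congr rfl fun μ hμ => by rw [if_pos (Finset.mem_inter.mp hμ).2]
      have h3 : ∑ μ ∈ P.support ∩ s, (h μ * rename Sum.inl (P.coeff μ) +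
            rename Sum.swap (map (starRingEnd ℂ) (h μ * rename Sum.inl (P.coeff μ)))) =
          ∑ μ ∈ s, (h μ * rename Sum.inl (P.coeff μ) +
            rename Sum.swap (map (starRingEnd ℂ) (h μ * rename Sum.inl (P.coeff μ)))) := by
        refine Finset.sum_subset Finset.inter_subset_right fun μ hμs hμ => ?_
        have hμP : μ ∉ P.support := fun hμP => hμ (Finset.mem_inter.mpr ⟨hμP, hμs⟩)
        have hc : P.coeff μ = 0 := MvPolynomial.notMem_support_iff.mp hμP
        rw [hc, map_zero, mul_zero, map_zero, map_zero, add_zero]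
      rw [h1, h2, h3]
    rw [hmid]
    exact hsum

/-- Settles `stmt-ValiantsHypothesis-5646` (`NsToSos`, route `RefutationDegree`): a
Nullstellensatz refutation of degree `d` of `Rep(n,m)` is a Hermitian-SOS refutation of degree
`d` (zero squares, `h' = -½ ·` the holomorphic lift of `h`; the conjugation is a ring map fixing
`1`), so `D_SOS ≤ D_NS`.  Inline NS certificate ⇒ `HasNSRefutationOfDegree`
(`hasNSRefutationOfDegree_coeff`) ⇒ `HasHermitianSosRefutationOfDegree`
(`HasNSRefutationOfDegree.hasHermitianSosRefutationOfDegree`, Krajíček 2019 §6.4) ⇒ inline SOS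
certificate (`exists_sos_certificate_support_of_hasHermitianSosRefutationOfDegree_coeff`).
[folklore] -/
theorem nsToSos_proof :
    Summit.ValiantsHypothesis.ValiantsHypothesis.Theses.RefutationDegree.NsToSos := by
  unfold Summit.ValiantsHypothesis.ValiantsHypothesis.Theses.RefutationDegree.NsToSos
  intro n m d hNS
  obtain ⟨h, hdeg, hsum⟩ := hNS
  exact exists_sos_certificate_support_of_hasHermitianSosRefutationOfDegree_coeff _ d
    (hasNSRefutationOfDegree_coeff _ d h hdeg hsum).hasHermitianSosRefutationOfDegree

end Summit.ValiantsHypothesis.ValiantsHypothesis.Theorems
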